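import Mathlib.Analysis.InnerProductSpace.PiL2
import Mathlib.Analysis.SpecialFunctions.Complex.Arg
import Mathlib.Algebra.Order.Floor.Ring
import Mathlib.Data.Int.Interval
import Literature.MathematicalPhysics.StatisticalMechanics.Theil2006Proofs

/-!
# Crux `ChessboardParticlePlanes.LjPlaneChessboard` (stmt-AtomisticToContinuum-6709), line `Sketch` —
# partner count: a `2/3`-separated planar set has at most six points in an open disk of radius `2/3`

The certificate argument of the crux charges cross-layer pairs of particles closer than the in-plane
hard core `2/3` ("partners").  A particle `x` can have only boundedly many partners in another
`2/3`-separated layer; this file proves the bound SIX (the sharp bound is five), which is what the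
phased partner accounting consumes:

* `partnerCount_le_six` — if `Y ⊂ ℝ²` is finite, `2/3`-separated, and every `y ∈ Y` satisfies
  `dist x y < 2/3`, then `|Y| ≤ 6`.

Proof (sectors + pigeonhole).  Read the vectors `y - x` as complex numbers `z y` (through the
isometry `Complex.orthonormalBasisOneI.repr.symm : EuclideanSpace ℝ (Fin 2) ≃ₗᵢ[ℝ] ℂ`) and sort
them into the six half-open angular sectors `⌊(π − arg) · 3/π⌋ ∈ {0, …, 5}`.  Two points in one
sector have `|arg z − arg z'| < π/3`, hence `cos (arg z − arg z') > 1/2`, and by the law of cosines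
(`Theil2006.norm_sub_sq_eq_cos_arg` of the Literature layer)
`|z − z'|² = a² + b² − 2ab cos < a² + b² − ab < 4/9` for radii `a, b < 2/3` — contradicting the
separation `2/3 ≤ dist y y'`.  (The degenerate case `y = x`, `z y = 0`, needs no special treatment:
the law of cosines holds with `arg 0 = 0`.)  With seven or more points two share a sector.

[folklore; the sector/pigeonhole count behind the kissing number of the disk]
-/

noncomputable section

namespace Summit.AtomisticToContinuum.Crystallization.Theorems.ChessboardParticlePlanesLjPlaneChessboard

open Complex (arg)
open scoped Real

/-- Two points of the open disk `|·| < 2/3` whose arguments differ by less than `π/3` are at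
distance `< 2/3`: with `a = |z|`, `b = |w|`, `|z - w|² = a² + b² − 2ab cos(arg z − arg w)
≤ a² + b² − ab < 4/9`, the last step being `(2/3 − a)(2/3 − b) > 0`, `a(2/3 − a) ≥ 0`,
`b(2/3 − b) ≥ 0`. [folklore] -/
theorem norm_sub_lt_of_abs_arg_sub_lt {z w : ℂ} (hz : ‖z‖ < 2 / 3) (hw : ‖w‖ < 2 / 3)
    (h : |arg z - arg w| < π / 3) : ‖z - w‖ < 2 / 3 := by
  have hcos : 1 / 2 < Real.cos (arg z - arg w) := by
    rw [← Real.cos_pi_div_three, ← Real.cos_abs (arg z - arg w)]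
    exact Real.cos_lt_cos_of_nonneg_of_le_pi (abs_nonneg _) (by linarith [Real.pi_pos]) h
  have hsq : ‖z - w‖ ^ 2 < (2 / 3) ^ 2 := by
    rw [Literature.MathematicalPhysics.StatisticalMechanics.Theil2006.norm_sub_sq_eq_cos_arg]
    have h0 : 0 ≤ ‖z‖ * ‖w‖ * (Real.cos (arg z - arg w) - 1 / 2) :=
      mul_nonneg (mul_nonneg (norm_nonneg _) (norm_nonneg _)) (sub_nonneg.2 hcos.le)
    nlinarith [mul_pos (sub_pos.2 hz) (sub_pos.2 hw), mul_nonneg (norm_nonneg z) (sub_pos.2 hz).le,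
      mul_nonneg (norm_nonneg w) (sub_pos.2 hw).le]
  exact lt_of_pow_lt_pow_left₀ 2 (by norm_num) hsq

/-- The angular sector index `⌊(π − arg z) · 3/π⌋` of a complex number lies in `{0, …, 5}`, since
`arg z ∈ (−π, π]`. [folklore] -/
theorem sector_mem_Icc (z : ℂ) : ⌊(π - arg z) * (3 / π)⌋ ∈ Finset.Icc (0 : ℤ) 5 := by
  have h1 := Complex.arg_le_pi z
  have h2 := Complex.neg_pi_lt_arg z
  have hπ := Real.pi_pos
  rw [Finset.mem_Icc]
  refine ⟨Int.floor_nonneg.2 (mul_nonneg (sub_nonneg.2 h1) (div_nonneg (by norm_num) hπ.le)), ?_⟩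
  have hlt : (π - arg z) * (3 / π) < 6 := by
    rw [mul_div_assoc', div_lt_iff₀ hπ]
    linarith
  have h6 : ⌊(π - arg z) * (3 / π)⌋ < 6 := Int.floor_lt.2 (by exact_mod_cast hlt)
  omega

/-- Two complex numbers with the same sector index have arguments closer than `π/3`. [folklore] -/
theorem abs_arg_sub_lt_of_sector_eq {z w : ℂ}
    (h : ⌊(π - arg z) * (3 / π)⌋ = ⌊(π - arg w) * (3 / π)⌋) : |arg z - arg w| < π / 3 := by
  have h1 : |(π - arg z) * (3 / π) - (π - arg w) * (3 / π)| < 1 :=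
    Int.abs_sub_lt_one_of_floor_eq_floor h
  have h3 : (0 : ℝ) < 3 / π := by positivity
  have : (π - arg z) * (3 / π) - (π - arg w) * (3 / π) = (arg w - arg z) * (3 / π) := by ring
  rw [this, abs_mul, abs_of_pos h3, ← lt_div_iff₀ h3, one_div_div, abs_sub_comm] at h1
  exact h1

/-- **Partner count (registered sub-goal of the phased partner accounting).**  A finite
`2/3`-separated set `Y` of the plane all of whose points lie at distance `< 2/3` from a point `x`
has at most six elements: in complex coordinates centred at `x`, two of seven points would fall in
one of the six angular sectors of opening `π/3`, hence (law of cosines, radii `< 2/3`) be closer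
than `2/3`. [folklore] -/
theorem partnerCount_le_six :
    ∀ (x : EuclideanSpace ℝ (Fin 2)) (Y : Finset (EuclideanSpace ℝ (Fin 2))),
      (∀ y ∈ Y, ∀ y' ∈ Y, y ≠ y' → (2 : ℝ) / 3 ≤ dist y y') → (∀ y ∈ Y, dist x y < 2 / 3) →
      Y.card ≤ 6 := by
  intro x Y hsep hclose
  by_contra! hcard
  -- complex coordinates centred at `x`
  obtain ⟨z, hz⟩ : ∃ z : EuclideanSpace ℝ (Fin 2) → ℂ,
      ∀ y, z y = Complex.orthonormalBasisOneI.repr.symm (y - x) := ⟨_, fun _ => rfl⟩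
  have hnorm : ∀ y, ‖z y‖ = dist x y := by
    intro y
    rw [hz, LinearIsometryEquiv.norm_map, ← dist_eq_norm, dist_comm]
  have hsub : ∀ y y', ‖z y - z y'‖ = dist y y' := by
    intro y y'
    rw [hz, hz, ← map_sub, LinearIsometryEquiv.norm_map, sub_sub_sub_cancel_right, dist_eq_norm]
  -- seven points, six sectors
  have hmaps : Set.MapsTo (fun y => ⌊(π - arg (z y)) * (3 / π)⌋) ↑Y ↑(Finset.Icc (0 : ℤ) 5) :=
    fun y _ => Finset.mem_coe.2 (sector_mem_Icc (z y))
  have hlt : (Finset.Icc (0 : ℤ) 5).card < Y.card := by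
    rw [Int.card_Icc]
    norm_num
    omega
  obtain ⟨y, hy, y', hy', hne, heq⟩ := Finset.exists_ne_map_eq_of_card_lt_of_maps_to hlt hmaps
  have hzy : ‖z y‖ < 2 / 3 := by rw [hnorm]; exact hclose y hy
  have hzy' : ‖z y'‖ < 2 / 3 := by rw [hnorm]; exact hclose y' hy'
  have h1 : ‖z y - z y'‖ < 2 / 3 :=
    norm_sub_lt_of_abs_arg_sub_lt hzy hzy' (abs_arg_sub_lt_of_sector_eq heq)
  rw [hsub] at h1
  exact absurd (hsep y hy y' hy' hne) (not_le.2 h1)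

end Summit.AtomisticToContinuum.Crystallization.Theorems.ChessboardParticlePlanesLjPlaneChessboard

end
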